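import Summits.HodgeConjecture.HodgeConjecture.Theorems.Ring2WeilCoverageCMFieldInertPrimes
import HarnessLib

/-!
# Non-split Weil-type components over quartic CM fields, III bis: descent at a GENERAL principal degree-one
# prime `π = u₀ + v₀σ` of `F` (`Nm π = ±ℓ`), and the half-split prime `17` of `ℚ(√-(3+√2))`

research route conditional on HC_CM; not a corollary; Q11.4-sentence-2 already refuted in dim ≥ 3.
Cell `pub-hodge-ring2`, seat `ring2-b03` (gen 50); kernel certificates for the Weil-type family-coverage census
`HOME/WEIL-FAMILY-COVERAGE.md` §b03.5. Gen 48's engine `Ring2WeilCoverageCMFieldDegreeOnePrimes` descends at a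
principal degree-one prime of the special form `π = t + σ` (`Nm π = R(-t)` prime) of `ℤ[σ] = ℤ[S]/(S² + pS + q)`;
a degree-one prime whose generators all have `σ`-coefficient `v₀ ≠ ±1` (e.g. the place `(17, √2 + 6) = (5 - 2√2) =
(11 + 2σ)` of `F = ℚ(√2)`, `σ = -(3+√2)`: `t² - 6t + 7 = ±17` has no integer root) is out of its reach. This file
removes the restriction:

* §1 the ENGINE `normSq_eq_zero_of_dvd_step_general` for `π = u₀ + v₀σ`, `L := Nm π = u₀² - pu₀v₀ + qv₀²`,
  `|L| = ℓ` prime, together with an integer `t` and `γ = g₀ + g₁σ ∈ ℤ[σ]` with `πγ = t + σ` (so `σ ≡ -t (mod π)`;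
  hypotheses `ht`, `hγ` are the two coordinates of that product): if every solution of `x² - σy² = n·m²`
  (`x, y, m ∈ ℤ[σ]`, coordinates `A, B, C, D, M₀, M₁`) has `L ∣ A - tB, C - tD, M₀ - tM₁` (`hdiv`), then `x = πx₁`
  (`x₁ = Bγ + aπ̄` for `A - tB = La`), `y = πy₁`, `m = πm₁`, `(x₁, y₁, m₁)` is again a solution (the coordinates of
  `π²·N₁ = N` inverted by `π̄²`: `L²·N₁ = π̄²·N`) and `Nm m = L·Nm m₁`, so descent on `|Nm m|` gives `Nm m = 0`;
  `rat_no_solution_of_dvd_step_general` (clearing denominators), and on Deligne's carriers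
  (`Deligne1982/WeilTypeCMDiscriminant`) the certificate `mk_ne_splitDiscriminantClassCM_of_dvd_step_general`:
  `[n] ≠ [(-1)²]` — the component `(E, 4, [n])` has no `E`-Lagrangian member (Deligne Cor. 4.2);
* §2 the SUPPLIER `dvd_step_general_of_inert` of `hdiv` for `n = L·w` at a prime `π` INERT in `E/F` (`-t` a
  non-square mod `ℓ`) and unramified in `F` (`ℓ ∤ 2t - p`, `ℓ ∤ v₀`), `ℓ ∤ w`: reduction mod `π` (`σ ↦ -t`) gives
  `x ≡ y ≡ 0`, then cancelling one `π` from `π²(x₁² - σy₁²) = ππ̄·w·m²` and reducing mod `π` gives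
  `v₀(2t - p)·w·m̄² = 0`; packaged certificate `mk_norm_mul_ne_splitDiscriminantClassCM_of_inert_general`;
* §3 the instance: **`[17w] ≠ [1]` in `F^×/Nm_{E/F}(E^×)` for the non-Galois field `E = ℚ(√-(3+√2))`
  (`R = S² + 6S + 7`), `17 ∤ w`** — `π = 11 + 2σ = 5 - 2√2`, `t = -3`, `γ = 1 + σ` (the conjugate place
  `(5 + 2√2)` splits in `E/F`; census §b03.5: `T(17) = {(17, √2+6), (7, √2+3)}`); this was the one obstruction type
  of the `ℚ(√-(3+√2))` table not reachable by the gens 46–48 criteria (there it was decided through the residue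
  at `(7, √2+3)` instead), needed for the class `[51] = [3]·[17]` (`T = {(√2), (17, √2+6)}`) of part VIII.

All substitutions are explicit polynomial identities (`linear_combination` / `ring`); no valuation theory is
imported. No named fact, no definition, no `sorry`; nothing about the Hodge conjecture is asserted.
References: [Deligne1982HodgeCycles] §4 p. 30 (1), Cor. 4.2, Lemma 4.6; [Landherr1936HermitianForms];
J. Neukirch, Algebraic Number Theory, I §8 (degree-one primes; only used in elementary explicit form). -/

noncomputable section

set_option linter.dupNamespace false

open Polynomial

namespace Summit.HodgeConjecture.HodgeConjecture.Ring2.WeilCoverageCM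

open Literature.AlgebraicGeometry.Deligne1982
open Literature.AlgebraicGeometry.HodgeTheory (splitDiscriminantClassCM)

/-! ### §1 The engine: descent at `π = u₀ + v₀σ`, `πγ = t + σ`, `|Nm π| = ℓ` -/

section Engine

variable (p q u₀ v₀ g₀ g₁ t : ℤ) (ℓ : ℕ) [hℓ : Fact ℓ.Prime]

/-- **Descent at a principal degree-one prime `π = u₀ + v₀σ` of `ℤ[σ] = ℤ[S]/(S² + pS + q)`**, `L = Nm π =
u₀² - pu₀v₀ + qv₀²`, `|L| = ℓ` prime, `γ = g₀ + g₁σ` with `πγ = t + σ`. In coordinates `x = A + Bσ`, `y = C + Dσ`,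
`m = M₀ + M₁σ` the equation `x² - σy² = n·m²` reads `X = n(M₀² - qM₁²)`, `Y = n(2M₀M₁ - pM₁²)`; if every solution
has `L ∣ A - tB`, `L ∣ C - tD`, `L ∣ M₀ - tM₁` (`hdiv`), then `Nm m = M₀² - pM₀M₁ + qM₁² = 0` for every solution
(`x = πx₁` with `x₁ = Bγ + aπ̄`, …, `L²·N(x₁, y₁, m₁) = π̄²·N(x, y, m) = 0`, `|Nm m| = ℓ·|Nm m₁|`). [folklore] -/
theorem normSq_eq_zero_of_dvd_step_general (hL : (u₀ ^ 2 - p * u₀ * v₀ + q * v₀ ^ 2).natAbs = ℓ)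
    (ht : u₀ * g₀ - q * v₀ * g₁ = t) (hγ : v₀ * g₀ + u₀ * g₁ - p * v₀ * g₁ = 1) (n : ℤ)
    (hdiv : ∀ A B C D M₀ M₁ : ℤ,
      A ^ 2 - q * B ^ 2 + 2 * q * C * D - p * q * D ^ 2 = n * (M₀ ^ 2 - q * M₁ ^ 2) →
      2 * A * B - p * B ^ 2 - C ^ 2 + 2 * p * C * D - (p ^ 2 - q) * D ^ 2 = n * (2 * M₀ * M₁ - p * M₁ ^ 2) →
        (u₀ ^ 2 - p * u₀ * v₀ + q * v₀ ^ 2 ∣ A - t * B) ∧ (u₀ ^ 2 - p * u₀ * v₀ + q * v₀ ^ 2 ∣ C - t * D) ∧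
          (u₀ ^ 2 - p * u₀ * v₀ + q * v₀ ^ 2 ∣ M₀ - t * M₁)) :
    ∀ (k : ℕ) (A B C D M₀ M₁ : ℤ), (M₀ ^ 2 - p * M₀ * M₁ + q * M₁ ^ 2).natAbs ≤ k →
      A ^ 2 - q * B ^ 2 + 2 * q * C * D - p * q * D ^ 2 = n * (M₀ ^ 2 - q * M₁ ^ 2) →
      2 * A * B - p * B ^ 2 - C ^ 2 + 2 * p * C * D - (p ^ 2 - q) * D ^ 2 = n * (2 * M₀ * M₁ - p * M₁ ^ 2) →
        M₀ ^ 2 - p * M₀ * M₁ + q * M₁ ^ 2 = 0 := by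
  set L : ℤ := u₀ ^ 2 - p * u₀ * v₀ + q * v₀ ^ 2 with hLdef
  have hℓ2 : 2 ≤ ℓ := hℓ.out.two_le
  have hL0 : L ≠ 0 := by
    intro h; rw [h, Int.natAbs_zero] at hL; omega
  intro k
  induction k with
  | zero => intro A B C D M₀ M₁ hk _ _; exact Int.natAbs_eq_zero.1 (Nat.eq_zero_of_le_zero hk)
  | succ k ih =>
    intro A B C D M₀ M₁ hk hX hY
    obtain ⟨⟨a, ha⟩, ⟨c, hc⟩, ⟨μ, hμ⟩⟩ := hdiv A B C D M₀ M₁ hX hY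
    -- the new solution `x₁ = Bγ + aπ̄`, `y₁ = Dγ + cπ̄`, `m₁ = M₁γ + μπ̄` (`π̄ = (u₀ - pv₀) - v₀σ`)
    obtain ⟨x0, hx0⟩ : ∃ x0 : ℤ, x0 = B * g₀ + a * (u₀ - p * v₀) := ⟨_, rfl⟩
    obtain ⟨x1, hx1⟩ : ∃ x1 : ℤ, x1 = B * g₁ - a * v₀ := ⟨_, rfl⟩
    obtain ⟨y0, hy0⟩ : ∃ y0 : ℤ, y0 = D * g₀ + c * (u₀ - p * v₀) := ⟨_, rfl⟩
    obtain ⟨y1, hy1⟩ : ∃ y1 : ℤ, y1 = D * g₁ - c * v₀ := ⟨_, rfl⟩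
    obtain ⟨m0, hm0⟩ : ∃ m0 : ℤ, m0 = M₁ * g₀ + μ * (u₀ - p * v₀) := ⟨_, rfl⟩
    obtain ⟨m1, hm1⟩ : ∃ m1 : ℤ, m1 = M₁ * g₁ - μ * v₀ := ⟨_, rfl⟩
    -- `x = πx₁`, `y = πy₁`, `m = πm₁` coordinatewise
    have cA : A = u₀ * x0 - q * v₀ * x1 := by rw [hx0, hx1]; linear_combination ha - B * ht
    have cB : B = v₀ * x0 + (u₀ - p * v₀) * x1 := by rw [hx0, hx1]; linear_combination -B * hγ
    have cC : C = u₀ * y0 - q * v₀ * y1 := by rw [hy0, hy1]; linear_combination hc - D * ht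
    have cD : D = v₀ * y0 + (u₀ - p * v₀) * y1 := by rw [hy0, hy1]; linear_combination -D * hγ
    have cM0 : M₀ = u₀ * m0 - q * v₀ * m1 := by rw [hm0, hm1]; linear_combination hμ - M₁ * ht
    have cM1 : M₁ = v₀ * m0 + (u₀ - p * v₀) * m1 := by rw [hm0, hm1]; linear_combination -M₁ * hγ
    clear hx0 hx1 hy0 hy1 hm0 hm1 ha hc hμ
    subst cA cC cM0
    rw [cB, cD] at hX hY
    rw [cM1] at hX hY hk ⊢
    -- `L²·N(x₁, y₁, m₁) = π̄²·N(x, y, m) = 0`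
    have hXn : L ^ 2 * (x0 ^ 2 - q * x1 ^ 2 + 2 * q * y0 * y1 - p * q * y1 ^ 2 - n * (m0 ^ 2 - q * m1 ^ 2)) = 0 := by
      rw [hLdef]
      linear_combination (u₀ ^ 2 - q * v₀ ^ 2 - p * (2 * u₀ * v₀ - p * v₀ ^ 2)) * hX
        + q * (2 * u₀ * v₀ - p * v₀ ^ 2) * hY
    have hYn : L ^ 2 * (2 * x0 * x1 - p * x1 ^ 2 - y0 ^ 2 + 2 * p * y0 * y1 - (p ^ 2 - q) * y1 ^ 2
        - n * (2 * m0 * m1 - p * m1 ^ 2)) = 0 := by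
      rw [hLdef]
      linear_combination (-(2 * u₀ * v₀ - p * v₀ ^ 2)) * hX + (u₀ ^ 2 - q * v₀ ^ 2) * hY
    have h2 : L ^ 2 ≠ 0 := pow_ne_zero 2 hL0
    have hX' : x0 ^ 2 - q * x1 ^ 2 + 2 * q * y0 * y1 - p * q * y1 ^ 2 = n * (m0 ^ 2 - q * m1 ^ 2) :=
      sub_eq_zero.1 ((mul_eq_zero.1 hXn).resolve_left h2)
    have hY' : 2 * x0 * x1 - p * x1 ^ 2 - y0 ^ 2 + 2 * p * y0 * y1 - (p ^ 2 - q) * y1 ^ 2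
        = n * (2 * m0 * m1 - p * m1 ^ 2) :=
      sub_eq_zero.1 ((mul_eq_zero.1 hYn).resolve_left h2)
    -- the norm of the multiplier drops by the factor `|L| = ℓ`
    have hN : (u₀ * m0 - q * v₀ * m1) ^ 2 - p * (u₀ * m0 - q * v₀ * m1) * (v₀ * m0 + (u₀ - p * v₀) * m1)
        + q * (v₀ * m0 + (u₀ - p * v₀) * m1) ^ 2 = L * (m0 ^ 2 - p * m0 * m1 + q * m1 ^ 2) := by
      rw [hLdef]; ring
    have hbound : (m0 ^ 2 - p * m0 * m1 + q * m1 ^ 2).natAbs ≤ k := by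
      rw [hN, Int.natAbs_mul, hL] at hk
      generalize (m0 ^ 2 - p * m0 * m1 + q * m1 ^ 2).natAbs = K at hk ⊢
      have h2K : 2 * K ≤ k + 1 := le_trans (Nat.mul_le_mul_right K hℓ2) hk
      omega
    rw [hN, ih _ _ _ _ _ _ hbound hX' hY', mul_zero]

/-- **No rational solutions** of `X = n`, `Y = 0` (the norm form `a² - σb²` of `E/F` does not represent the
rational integer `n`) once the descent hypothesis `hdiv` of `normSq_eq_zero_of_dvd_step_general` holds: clear
denominators (`m ∈ ℤ_{>0}`, `Nm m = m² ≠ 0`). [folklore] -/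
theorem rat_no_solution_of_dvd_step_general (hL : (u₀ ^ 2 - p * u₀ * v₀ + q * v₀ ^ 2).natAbs = ℓ)
    (ht : u₀ * g₀ - q * v₀ * g₁ = t) (hγ : v₀ * g₀ + u₀ * g₁ - p * v₀ * g₁ = 1) (n : ℤ)
    (hdiv : ∀ A B C D M₀ M₁ : ℤ,
      A ^ 2 - q * B ^ 2 + 2 * q * C * D - p * q * D ^ 2 = n * (M₀ ^ 2 - q * M₁ ^ 2) →
      2 * A * B - p * B ^ 2 - C ^ 2 + 2 * p * C * D - (p ^ 2 - q) * D ^ 2 = n * (2 * M₀ * M₁ - p * M₁ ^ 2) →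
        (u₀ ^ 2 - p * u₀ * v₀ + q * v₀ ^ 2 ∣ A - t * B) ∧ (u₀ ^ 2 - p * u₀ * v₀ + q * v₀ ^ 2 ∣ C - t * D) ∧
          (u₀ ^ 2 - p * u₀ * v₀ + q * v₀ ^ 2 ∣ M₀ - t * M₁))
    (a₀ a₁ b₀ b₁ : ℚ)
    (hX : a₀ ^ 2 - q * a₁ ^ 2 + 2 * q * b₀ * b₁ - p * q * b₁ ^ 2 = n)
    (hY : 2 * a₀ * a₁ - p * a₁ ^ 2 - b₀ ^ 2 + 2 * p * b₀ * b₁ - (p ^ 2 - q) * b₁ ^ 2 = 0) : False := by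
  set m : ℕ := a₀.den * a₁.den * b₀.den * b₁.den with hm
  have hm0 : (m : ℤ) ≠ 0 := by
    have : 0 < m := by
      rw [hm]; exact Nat.mul_pos (Nat.mul_pos (Nat.mul_pos a₀.den_pos a₁.den_pos) b₀.den_pos) b₁.den_pos
    exact_mod_cast this.ne'
  have key : ∀ (r : ℚ) (k : ℕ), ((r.num * k : ℤ) : ℚ) = r * (r.den * k : ℕ) := by
    intro r k
    push_cast
    rw [← mul_assoc, Rat.mul_den_eq_num]
  obtain ⟨A, hA⟩ : ∃ A : ℤ, (A : ℚ) = a₀ * m :=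
    ⟨a₀.num * (a₁.den * b₀.den * b₁.den : ℕ), by rw [key, hm]; push_cast; ring⟩
  obtain ⟨B, hB⟩ : ∃ B : ℤ, (B : ℚ) = a₁ * m :=
    ⟨a₁.num * (a₀.den * b₀.den * b₁.den : ℕ), by rw [key, hm]; push_cast; ring⟩
  obtain ⟨Cc, hC⟩ : ∃ Cc : ℤ, (Cc : ℚ) = b₀ * m :=
    ⟨b₀.num * (a₀.den * a₁.den * b₁.den : ℕ), by rw [key, hm]; push_cast; ring⟩
  obtain ⟨D, hD⟩ : ∃ D : ℤ, (D : ℚ) = b₁ * m :=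
    ⟨b₁.num * (a₀.den * a₁.den * b₀.den : ℕ), by rw [key, hm]; push_cast; ring⟩
  have hXZ : A ^ 2 - q * B ^ 2 + 2 * q * Cc * D - p * q * D ^ 2 = n * ((m : ℤ) ^ 2 - q * 0 ^ 2) := by
    have h : (A : ℚ) ^ 2 - q * (B : ℚ) ^ 2 + 2 * q * (Cc : ℚ) * D - p * q * (D : ℚ) ^ 2 =
        n * (((m : ℤ) : ℚ) ^ 2 - q * 0 ^ 2) := by
      rw [hA, hB, hC, hD]; push_cast; linear_combination ((m : ℚ)) ^ 2 * hX
    exact_mod_cast h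
  have hYZ : 2 * A * B - p * B ^ 2 - Cc ^ 2 + 2 * p * Cc * D - (p ^ 2 - q) * D ^ 2
      = n * (2 * (m : ℤ) * 0 - p * 0 ^ 2) := by
    have h : 2 * (A : ℚ) * B - p * (B : ℚ) ^ 2 - (Cc : ℚ) ^ 2 + 2 * p * (Cc : ℚ) * D
        - (p ^ 2 - q) * (D : ℚ) ^ 2 = n * (2 * ((m : ℤ) : ℚ) * 0 - p * 0 ^ 2) := by
      rw [hA, hB, hC, hD]; linear_combination ((m : ℚ)) ^ 2 * hY
    exact_mod_cast h
  have h := normSq_eq_zero_of_dvd_step_general p q u₀ v₀ g₀ g₁ t ℓ hL ht hγ n hdiv _ A B Cc D m 0 le_rfl hXZ hYZ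
  have : (m : ℤ) ^ 2 = 0 := by linear_combination h
  exact hm0 (pow_eq_zero_iff (n := 2) (by norm_num) |>.1 this)

end Engine

/-- **Non-split criterion from a general degree-one descent (generic).** For `R = S² + pS + q` with both carrier
polynomials irreducible (instance arguments), `π = u₀ + v₀σ` with `|Nm π| = ℓ` prime and `πγ = t + σ`
(`γ = g₀ + g₁σ`), and a rational integer `n` for which every solution of `x² - σy² = n·m²` in `ℤ[σ]` is
`≡ 0 (mod π)` (`hdiv`): the class of `n` in `F^×/Nm_{E/F}(E^×)` is not the split class `[(-1)²]` of `E`-rank `4` —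
the Weil-type component `(E, d = 4, δ = [n])` has no `E`-Lagrangian member.
[cite: Deligne1982HodgeCycles, §4 p. 30 (1) and Cor. 4.2] [cite: Landherr1936HermitianForms] -/
theorem mk_ne_splitDiscriminantClassCM_of_dvd_step_general {p q : ℤ} {R : Polynomial ℤ}
    (hR : R = X ^ 2 + C p * X + C q) [Fact (Irreducible (realPolyQ R))] [Fact (Irreducible (cmPolyQ R))]
    (u₀ v₀ g₀ g₁ t : ℤ) (ℓ : ℕ) [Fact ℓ.Prime] (hL : (u₀ ^ 2 - p * u₀ * v₀ + q * v₀ ^ 2).natAbs = ℓ)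
    (ht : u₀ * g₀ - q * v₀ * g₁ = t) (hγ : v₀ * g₀ + u₀ * g₁ - p * v₀ * g₁ = 1) (n : ℤ)
    (hdiv : ∀ A B C D M₀ M₁ : ℤ,
      A ^ 2 - q * B ^ 2 + 2 * q * C * D - p * q * D ^ 2 = n * (M₀ ^ 2 - q * M₁ ^ 2) →
      2 * A * B - p * B ^ 2 - C ^ 2 + 2 * p * C * D - (p ^ 2 - q) * D ^ 2 = n * (2 * M₀ * M₁ - p * M₁ ^ 2) →
        (u₀ ^ 2 - p * u₀ * v₀ + q * v₀ ^ 2 ∣ A - t * B) ∧ (u₀ ^ 2 - p * u₀ * v₀ + q * v₀ ^ 2 ∣ C - t * D) ∧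
          (u₀ ^ 2 - p * u₀ * v₀ + q * v₀ ^ 2 ∣ M₀ - t * M₁))
    (u : (realField R)ˣ) (hu : (u : realField R) = AdjoinRoot.of (realPolyQ R) n) :
    (QuotientGroup.mk u : cmNormResidueGroup R) ≠ splitDiscriminantClassCM R 2 := by
  intro h
  rw [splitDiscriminantClassCM, neg_one_sq] at h
  obtain ⟨z, -, hz⟩ := exists_eq_ratCast_mul_norm_of_mk_eq (q := u) (u := 1) (c := 1)
    (by rw [Units.val_one, Rat.cast_one]) h
  rw [Rat.cast_one, one_mul] at hz
  obtain ⟨a, b, rfl⟩ := exists_eq_realToCM_add_mul_cmRoot R z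
  rw [norm_coords, algebraMap_realField_eq, hu] at hz
  have hF := (realToCM R).injective hz
  obtain ⟨a₀, a₁, rfl⟩ := exists_coords_quadratic hR a
  obtain ⟨b₀, b₁, rfl⟩ := exists_coords_quadratic hR b
  rw [normForm_coords hR] at hF
  have key : AdjoinRoot.of (realPolyQ R) (a₀ ^ 2 - q * a₁ ^ 2 + 2 * q * b₀ * b₁ - p * q * b₁ ^ 2 - n) +
      AdjoinRoot.of (realPolyQ R) (2 * a₀ * a₁ - p * a₁ ^ 2 - b₀ ^ 2 + 2 * p * b₀ * b₁ - (p ^ 2 - q) * b₁ ^ 2) *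
        AdjoinRoot.root (realPolyQ R) = 0 := by
    rw [map_sub, sub_add_eq_add_sub, sub_eq_zero]
    exact hF.symm
  obtain ⟨hX, hY⟩ := coords_eq_zero_quadratic hR key
  exact rat_no_solution_of_dvd_step_general p q u₀ v₀ g₀ g₁ t ℓ hL ht hγ n hdiv a₀ a₁ b₀ b₁ (by linarith) hY

/-! ### §2 The supplier at a prime `π = u₀ + v₀σ` INERT in `E/F` and unramified in `F`: classes `[L·w]`, `ℓ ∤ w` -/

/-- **(H, general) `π = u₀ + v₀σ`, `|Nm π| = ℓ`, `πγ = t + σ`, INERT in `E/F`, classes `[Lw]`, `ℓ ∤ w`.** If `-t ≡ σ`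
is a NON-SQUARE mod `ℓ` (the place `(π)` is inert in `E = F(√σ)`), `ℓ ∤ 2t - p` and `ℓ ∤ v₀` (`π̄ ∉ (π)`), and
`ℓ ∤ w` (`v_π(Lw)` is odd), then every solution of `x² - σy² = Lw·m²` has `x ≡ y ≡ m ≡ 0 (mod π)`: reducing mod
`π` (`σ ↦ -t`), `x̄² + tȳ² = 0` forces `x̄ = ȳ = 0`; then `x = πx₁`, `y = πy₁`, and `π(x₁² - σy₁²) = π̄·w·m²`
(one `π` cancelled) reduces mod `π` to `v₀(2t - p)·w·m̄² = 0`. Nothing is asked of the conjugate place `(π̄)`,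
which may split in `E/F` (non-Galois `E`). [folklore] -/
theorem dvd_step_general_of_inert (p q u₀ v₀ g₀ g₁ t : ℤ) (ℓ : ℕ) (hℓ : ℓ.Prime)
    (hL : (u₀ ^ 2 - p * u₀ * v₀ + q * v₀ ^ 2).natAbs = ℓ)
    (ht : u₀ * g₀ - q * v₀ * g₁ = t) (hγ : v₀ * g₀ + u₀ * g₁ - p * v₀ * g₁ = 1)
    (hns : ∀ s : ZMod ℓ, s ^ 2 ≠ -(t : ZMod ℓ)) (h2t : ¬ (ℓ : ℤ) ∣ 2 * t - p) (hv : ¬ (ℓ : ℤ) ∣ v₀)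
    (w : ℤ) (hw : ¬ (ℓ : ℤ) ∣ w) :
    ∀ A B C D M₀ M₁ : ℤ,
      A ^ 2 - q * B ^ 2 + 2 * q * C * D - p * q * D ^ 2 =
          (u₀ ^ 2 - p * u₀ * v₀ + q * v₀ ^ 2) * w * (M₀ ^ 2 - q * M₁ ^ 2) →
      2 * A * B - p * B ^ 2 - C ^ 2 + 2 * p * C * D - (p ^ 2 - q) * D ^ 2
          = (u₀ ^ 2 - p * u₀ * v₀ + q * v₀ ^ 2) * w * (2 * M₀ * M₁ - p * M₁ ^ 2) →
        (u₀ ^ 2 - p * u₀ * v₀ + q * v₀ ^ 2 ∣ A - t * B) ∧ (u₀ ^ 2 - p * u₀ * v₀ + q * v₀ ^ 2 ∣ C - t * D) ∧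
          (u₀ ^ 2 - p * u₀ * v₀ + q * v₀ ^ 2 ∣ M₀ - t * M₁) := by
  haveI : Fact ℓ.Prime := ⟨hℓ⟩
  set L : ℤ := u₀ ^ 2 - p * u₀ * v₀ + q * v₀ ^ 2 with hLdef
  have hℓp : Prime (ℓ : ℤ) := Nat.prime_iff_prime_int.1 hℓ
  have hL0 : L ≠ 0 := by
    intro h; rw [h, Int.natAbs_zero] at hL; exact hℓ.ne_zero hL.symm
  -- `ℓ ∣ z ↔ L ∣ z`
  have hdvd : ∀ z : ℤ, (ℓ : ℤ) ∣ z ↔ L ∣ z := fun z => by rw [← hL]; exact Int.natAbs_dvd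
  have hLz : ((L : ℤ) : ZMod ℓ) = 0 := by
    rw [ZMod.intCast_zmod_eq_zero_iff_dvd, hdvd]
  -- `R(-t) = L·Nm γ` and `u₀ - v₀t = g₁L` (from `πγ = t + σ`)
  have hr : t ^ 2 - p * t + q = L * (g₀ ^ 2 - p * g₀ * g₁ + q * g₁ ^ 2) := by
    rw [← ht, hLdef]
    linear_combination (p * (u₀ * g₀ - q * v₀ * g₁) - q - q * (v₀ * g₀ + u₀ * g₁ - p * v₀ * g₁)) * hγ
  have hπ : u₀ - v₀ * t = g₁ * L := by rw [hLdef]; linear_combination v₀ * ht - u₀ * hγ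
  have hrz : (t : ZMod ℓ) ^ 2 - (p : ZMod ℓ) * (t : ZMod ℓ) + (q : ZMod ℓ) = 0 := by
    have := congrArg (Int.cast : ℤ → ZMod ℓ) hr
    push_cast at this
    rw [this, hLz, zero_mul]
  have hπz : (u₀ : ZMod ℓ) - (v₀ : ZMod ℓ) * (t : ZMod ℓ) = 0 := by
    have := congrArg (Int.cast : ℤ → ZMod ℓ) hπ
    push_cast at this
    rw [this, hLz, mul_zero]
  have hwz : ((w : ZMod ℓ)) ≠ 0 := by rwa [Ne, ZMod.intCast_zmod_eq_zero_iff_dvd]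
  have hvz : ((v₀ : ZMod ℓ)) ≠ 0 := by rwa [Ne, ZMod.intCast_zmod_eq_zero_iff_dvd]
  have h2tz : (2 * (t : ZMod ℓ) - (p : ZMod ℓ)) ≠ 0 := by
    intro h
    apply h2t
    rw [← ZMod.intCast_zmod_eq_zero_iff_dvd]
    push_cast
    exact h
  have sq_zero : ∀ x : ZMod ℓ, x ^ 2 = 0 → x = 0 := fun x hx => pow_eq_zero_iff (n := 2) (by norm_num) |>.1 hx
  intro A B C D M₀ M₁ hX hY
  -- (i) reduction mod `π`: `(A - tB)² + t(C - tD)² ≡ 0`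
  have h1 : (A - t * B) ^ 2 + t * (C - t * D) ^ 2 - L * w * (M₀ - t * M₁) ^ 2
      + (t ^ 2 - p * t + q) * (-B ^ 2 + 2 * C * D - (t + p) * D ^ 2 + L * w * M₁ ^ 2) = 0 := by
    linear_combination hX - t * hY
  have hφ : ((A : ZMod ℓ) - (t : ZMod ℓ) * (B : ZMod ℓ)) ^ 2
      + (t : ZMod ℓ) * ((C : ZMod ℓ) - (t : ZMod ℓ) * (D : ZMod ℓ)) ^ 2 = 0 := by
    have := congrArg (Int.cast : ℤ → ZMod ℓ) h1
    push_cast at this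
    rw [hLz, hrz] at this
    linear_combination this
  -- anisotropy: `-t` is a non-square
  have hvv : ((C : ZMod ℓ) - (t : ZMod ℓ) * (D : ZMod ℓ)) = 0 := by
    by_contra hvv
    refine hns (((A : ZMod ℓ) - (t : ZMod ℓ) * (B : ZMod ℓ)) / ((C : ZMod ℓ) - (t : ZMod ℓ) * (D : ZMod ℓ))) ?_
    field_simp
    linear_combination hφ
  have huu : ((A : ZMod ℓ) - (t : ZMod ℓ) * (B : ZMod ℓ)) = 0 := by
    refine sq_zero _ ?_
    linear_combination hφ - (t : ZMod ℓ) * ((C : ZMod ℓ) - (t : ZMod ℓ) * (D : ZMod ℓ)) * hvv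
  have hu' : ((A - t * B : ℤ) : ZMod ℓ) = 0 := by push_cast; exact huu
  have hv' : ((C - t * D : ℤ) : ZMod ℓ) = 0 := by push_cast; exact hvv
  rw [ZMod.intCast_zmod_eq_zero_iff_dvd, hdvd] at hu' hv'
  refine ⟨hu', hv', ?_⟩
  obtain ⟨a, ha⟩ := hu'
  obtain ⟨c, hc⟩ := hv'
  -- (ii) `x = πx₁`, `y = πy₁` coordinatewise
  obtain ⟨x0, hx0⟩ : ∃ x0 : ℤ, x0 = B * g₀ + a * (u₀ - p * v₀) := ⟨_, rfl⟩
  obtain ⟨x1, hx1⟩ : ∃ x1 : ℤ, x1 = B * g₁ - a * v₀ := ⟨_, rfl⟩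
  obtain ⟨y0, hy0⟩ : ∃ y0 : ℤ, y0 = D * g₀ + c * (u₀ - p * v₀) := ⟨_, rfl⟩
  obtain ⟨y1, hy1⟩ : ∃ y1 : ℤ, y1 = D * g₁ - c * v₀ := ⟨_, rfl⟩
  have cA : A = u₀ * x0 - q * v₀ * x1 := by rw [hx0, hx1]; linear_combination ha - B * ht
  have cB : B = v₀ * x0 + (u₀ - p * v₀) * x1 := by rw [hx0, hx1]; linear_combination -B * hγ
  have cC : C = u₀ * y0 - q * v₀ * y1 := by rw [hy0, hy1]; linear_combination hc - D * ht
  have cD : D = v₀ * y0 + (u₀ - p * v₀) * y1 := by rw [hy0, hy1]; linear_combination -D * hγ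
  clear hx0 hx1 hy0 hy1 ha hc
  subst cA cC
  rw [cB, cD] at hX hY
  -- cancel one `π`: `Z := π·(x₁² - σy₁²) - π̄·w·m² = 0` (from `π·Z = 0`, multiplying by `π̄`)
  have hZ0 : L * (u₀ * (x0 ^ 2 - q * x1 ^ 2 + 2 * q * y0 * y1 - p * q * y1 ^ 2)
      - q * v₀ * (2 * x0 * x1 - p * x1 ^ 2 - y0 ^ 2 + 2 * p * y0 * y1 - (p ^ 2 - q) * y1 ^ 2)
      - w * ((u₀ - p * v₀) * (M₀ ^ 2 - q * M₁ ^ 2) + q * v₀ * (2 * M₀ * M₁ - p * M₁ ^ 2))) = 0 := by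
    rw [hLdef]; linear_combination (u₀ - p * v₀) * hX + q * v₀ * hY
  have hZ1 : L * (v₀ * (x0 ^ 2 - q * x1 ^ 2 + 2 * q * y0 * y1 - p * q * y1 ^ 2)
      + (u₀ - p * v₀) * (2 * x0 * x1 - p * x1 ^ 2 - y0 ^ 2 + 2 * p * y0 * y1 - (p ^ 2 - q) * y1 ^ 2)
      - w * (-v₀ * (M₀ ^ 2 - q * M₁ ^ 2) + u₀ * (2 * M₀ * M₁ - p * M₁ ^ 2))) = 0 := by
    rw [hLdef]; linear_combination (-v₀) * hX + u₀ * hY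
  have hZ0' := (mul_eq_zero.1 hZ0).resolve_left hL0
  have hZ1' := (mul_eq_zero.1 hZ1).resolve_left hL0
  -- reduce `Z` mod `π`: `Z₀ - tZ₁ = (u₀ - tv₀)·P₁ - R(-t)·P₂ - v₀(2t - p)·w·(M₀ - tM₁)²`
  have h3 : w * v₀ * (2 * t - p) * (M₀ - t * M₁) ^ 2 =
      (u₀ - v₀ * t) * ((x0 ^ 2 - q * x1 ^ 2 + 2 * q * y0 * y1 - p * q * y1 ^ 2)
          - t * (2 * x0 * x1 - p * x1 ^ 2 - y0 ^ 2 + 2 * p * y0 * y1 - (p ^ 2 - q) * y1 ^ 2)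
          - w * (M₀ ^ 2 - q * M₁ ^ 2) + t * w * (2 * M₀ * M₁ - p * M₁ ^ 2))
      - (t ^ 2 - p * t + q) * (v₀ * (2 * x0 * x1 - p * x1 ^ 2 - y0 ^ 2 + 2 * p * y0 * y1 - (p ^ 2 - q) * y1 ^ 2)
          + w * v₀ * (2 * M₀ * M₁ - 2 * t * M₁ ^ 2))
      - ((u₀ * (x0 ^ 2 - q * x1 ^ 2 + 2 * q * y0 * y1 - p * q * y1 ^ 2)
          - q * v₀ * (2 * x0 * x1 - p * x1 ^ 2 - y0 ^ 2 + 2 * p * y0 * y1 - (p ^ 2 - q) * y1 ^ 2)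
          - w * ((u₀ - p * v₀) * (M₀ ^ 2 - q * M₁ ^ 2) + q * v₀ * (2 * M₀ * M₁ - p * M₁ ^ 2)))
        - t * (v₀ * (x0 ^ 2 - q * x1 ^ 2 + 2 * q * y0 * y1 - p * q * y1 ^ 2)
          + (u₀ - p * v₀) * (2 * x0 * x1 - p * x1 ^ 2 - y0 ^ 2 + 2 * p * y0 * y1 - (p ^ 2 - q) * y1 ^ 2)
          - w * (-v₀ * (M₀ ^ 2 - q * M₁ ^ 2) + u₀ * (2 * M₀ * M₁ - p * M₁ ^ 2)))) := by
    ring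
  rw [hZ0', hZ1'] at h3
  have h4 : (w : ZMod ℓ) * (v₀ : ZMod ℓ) * (2 * (t : ZMod ℓ) - (p : ZMod ℓ))
      * ((M₀ : ZMod ℓ) - (t : ZMod ℓ) * (M₁ : ZMod ℓ)) ^ 2 = 0 := by
    have := congrArg (Int.cast : ℤ → ZMod ℓ) h3
    push_cast at this
    rw [this, hπz, hrz]
    ring
  have hm : ((M₀ : ZMod ℓ) - (t : ZMod ℓ) * (M₁ : ZMod ℓ)) = 0 := by
    rcases mul_eq_zero.1 h4 with h5 | h5
    · rcases mul_eq_zero.1 h5 with h6 | h6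
      · rcases mul_eq_zero.1 h6 with h7 | h7
        · exact absurd h7 hwz
        · exact absurd h7 hvz
      · exact absurd h6 h2tz
    · exact sq_zero _ h5
  have hm' : ((M₀ - t * M₁ : ℤ) : ZMod ℓ) = 0 := by push_cast; exact hm
  rw [ZMod.intCast_zmod_eq_zero_iff_dvd, hdvd] at hm'
  exact hm'

/-- **Non-split criterion at a general principal degree-one prime `π = u₀ + v₀σ` inert in `E/F`.** For
`R = S² + pS + q` in the CM regime (`0 < p`, `4q < p²`, `p² - 4q` not a rational square), `|Nm π| = ℓ` prime with
`πγ = t + σ`, `-t` a non-square mod `ℓ`, `ℓ ∤ 2t - p`, `ℓ ∤ v₀`, and `ℓ ∤ w`: `[Nm π · w] ≠ [(-1)²] = [1]` in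
`F^×/Nm_{E/F}(E^×)` — the obstruction sits at the ONE place `(π)` over `ℓ`, whatever the conjugate place does.
[cite: Deligne1982HodgeCycles, §4 p. 30 (1) and Cor. 4.2] [cite: Landherr1936HermitianForms] -/
theorem mk_norm_mul_ne_splitDiscriminantClassCM_of_inert_general {p q : ℤ} {R : Polynomial ℤ}
    (hR : R = X ^ 2 + C p * X + C q) [Fact (Irreducible (realPolyQ R))]
    (hp : 0 < p) (h4 : 4 * q < p ^ 2) (hD : ∀ r : ℚ, r ^ 2 ≠ (p : ℚ) ^ 2 - 4 * q)
    (u₀ v₀ g₀ g₁ t : ℤ) (ℓ : ℕ) (hℓ : ℓ.Prime) (hL : (u₀ ^ 2 - p * u₀ * v₀ + q * v₀ ^ 2).natAbs = ℓ)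
    (ht : u₀ * g₀ - q * v₀ * g₁ = t) (hγ : v₀ * g₀ + u₀ * g₁ - p * v₀ * g₁ = 1)
    (hns : ∀ s : ZMod ℓ, s ^ 2 ≠ -(t : ZMod ℓ)) (h2t : ¬ (ℓ : ℤ) ∣ 2 * t - p) (hv : ¬ (ℓ : ℤ) ∣ v₀)
    (w : ℤ) (hw : ¬ (ℓ : ℤ) ∣ w) (u : (realField R)ˣ)
    (hu : (u : realField R) = AdjoinRoot.of (realPolyQ R) (((u₀ ^ 2 - p * u₀ * v₀ + q * v₀ ^ 2) * w : ℤ) : ℚ)) :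
    (QuotientGroup.mk u : cmNormResidueGroup R) ≠ splitDiscriminantClassCM R 2 := by
  haveI : Fact ℓ.Prime := ⟨hℓ⟩
  haveI : Fact (Irreducible (cmPolyQ R)) := fact_irreducible_cmPolyQ_of_pos hR hp h4 hD
  refine mk_ne_splitDiscriminantClassCM_of_dvd_step_general hR u₀ v₀ g₀ g₁ t ℓ hL ht hγ
    ((u₀ ^ 2 - p * u₀ * v₀ + q * v₀ ^ 2) * w) ?_ u hu
  intro A B C D M₀ M₁ hX hY
  exact dvd_step_general_of_inert p q u₀ v₀ g₀ g₁ t ℓ hℓ hL ht hγ hns h2t hv w hw A B C D M₀ M₁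
    (by linear_combination hX) (by linear_combination hY)

/-! ### §3 Instance: `E = ℚ(√-(3+√2))`, `R = S² + 6S + 7`; the half-split prime `17`: `π = 11 + 2σ = 5 - 2√2` -/

/-- **`[17w] ≠ [1]` for the non-Galois field `E = ℚ(√-(3+√2))`, `17 ∤ w`** — the obstruction at the place
`(17, √2 + 6) = (5 - 2√2) = (11 + 2σ)` of `F = ℚ(√2)` (`σ = -(3+√2)`), INERT in `E/F` (`σ ≡ 3 (mod π)`, a
non-square mod `17`), whose conjugate `(5 + 2√2)` SPLITS in `E/F`; data `π = 11 + 2σ` (`Nm π = 121 - 132 + 28 =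
17`), `t = -3`, `γ = 1 + σ` (`πγ = -3 + σ`), `2t - p = -12`, `v₀ = 2`. Census §b03.5: `T(17) = {(17, √2+6),
(7, √2+3)}`, `T(34) = T(17)`, `T(51) = {(√2), (17, √2+6)}` — the last is reachable by NO residue criterion at an
inert, ramified or `t + σ` place. [cite: Deligne1982HodgeCycles, §4 p. 30 (1) and Cor. 4.2]
[cite: Landherr1936HermitianForms] -/
theorem sqrtNegThreePlusSqrtTwo_mk_seventeen_mul_ne_splitDiscriminantClassCM {R : Polynomial ℤ}
    (hR : R = X ^ 2 + C 6 * X + C 7) [Fact (Irreducible (realPolyQ R))] (w : ℤ) (hw : ¬ (17 : ℤ) ∣ w)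
    (u : (realField R)ˣ) (hu : (u : realField R) = AdjoinRoot.of (realPolyQ R) (17 * w)) :
    (QuotientGroup.mk u : cmNormResidueGroup R) ≠ splitDiscriminantClassCM R 2 :=
  mk_norm_mul_ne_splitDiscriminantClassCM_of_inert_general hR (by norm_num) (by norm_num) disc_not_sq_six_seven
    11 2 1 1 (-3) 17 (by norm_num) (by decide) (by norm_num) (by norm_num) (by decide) (by decide) (by decide) w
    (by exact_mod_cast hw) u (by rw [hu]; norm_num)

/-- **`[17] ≠ [1]` and `[51] ≠ [1]` for `ℚ(√-(3+√2))`** with `R = S² + 6S + 7` LITERALLY (`51 = 17·3`: the class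
`[3]·[17]`, `T = {(√2), (17, √2+6)}`). [cite: Deligne1982HodgeCycles, §4 p. 30 (1) and Cor. 4.2] -/
theorem sqrtNegThreePlusSqrtTwo_fiftyOne_nonsplit :
    haveI := fact_irreducible_realPolyQ_of_not_sq (R := X ^ 2 + C 6 * X + C 7) rfl disc_not_sq_six_seven
    ∀ u : (realField (X ^ 2 + C 6 * X + C 7))ˣ, (u : realField (X ^ 2 + C 6 * X + C 7)) = 51 →
      (QuotientGroup.mk u : cmNormResidueGroup (X ^ 2 + C 6 * X + C 7)) ≠
        splitDiscriminantClassCM (X ^ 2 + C 6 * X + C 7) 2 := by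
  haveI := fact_irreducible_realPolyQ_of_not_sq (R := X ^ 2 + C 6 * X + C 7) rfl disc_not_sq_six_seven
  exact fun u hu => sqrtNegThreePlusSqrtTwo_mk_seventeen_mul_ne_splitDiscriminantClassCM rfl 3 (by norm_num) u
    (by rw [hu]; norm_num)

end Summit.HodgeConjecture.HodgeConjecture.Ring2.WeilCoverageCM

end
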